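import Summits.BirchSwinnertonDyer.BirchSwinnertonDyer.Theorems.QuadraticBranchSignedControlPlusEtaLowerInclusionOfMissingLowerBound
import HarnessLib

/-!
# Route `QuadraticBranchSignedControl` (rung K8, cell `bsd-potss`), crux `PlusEtaLowerInclusion` (item
# stmt-BirchSwinnertonDyer-19601): the registered stub `stub_etaLower_r0_ofLowerBSD` of skeleton v3 BY NAME
# (planner bsd-potss-plan g16, 20:09Z, sha `d4fe313566d0`)

CONVERSE CONTROL modulo the named facts, in the cell's L₀ currency: Poitou–Tate duality for Selmer structures,
Kobayashi 2003 Thm 2.2 / 4.1 at `η`, Kitajima–Otsuki 2018 Thm 1.3, modularity, GZK ⟹ on every `p`-adic-tower-onto Gss2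
pair `(V, W)` (`V = W ⊗ χ_{p*}` good supersingular with `a_p(V) = 0`, `p ≥ 5`) with `L(W,1) ≠ 0`:
`MissingLowerBoundAt W p → QuadraticBranchPlusEtaLowerInclusionAt V p`. One theorem, NAME = the registered stub, STATEMENT =
the registered `Sig.stub_etaLower_r0_ofLowerBSD` text byte-for-byte (no local abbreviation), PROOF = one line over the accepted
`ConverseControl.quadraticBranchPlusEtaLowerInclusionAt_of_missingLowerBoundAt_of_surjective` (seat bsd-potss-ctrl g4,
`…PlusEtaLowerInclusionOfMissingLowerBound.lean`, p463421/p465291; content credit: ctrl g4 — reverse transport p462738 + B.D. Kim's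
rank-0 formula with the Tamagawa defect under Poitou–Tate). CONDITIONAL on the five named facts exactly as there; nothing new
asserted; crux 19601 stays OPEN (the L₀ statements `stub_etaLower_r0_lowerBSD` per pair remain); nothing booked. File prepared by
the planner (HOME/plan/edit-g16/bc/prepared/), scratch-verified; to be proposed by a prover seat
`--supports stmt-BirchSwinnertonDyer-19601` (plain).
-/

set_option autoImplicit false
set_option linter.dupNamespace false

noncomputable section

open scoped Classical

open WeierstrassCurve Literature.NumberTheory.EllipticCurves Literature.NumberTheory.GaloisCohomology
open Literature.NumberTheory.EllipticCurves.Rank1Residual.Typed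
open Summit.BirchSwinnertonDyer.Rank1Residual.Additive

namespace Summit.BirchSwinnertonDyer.BirchSwinnertonDyer.Theorems.PlusEtaLowerInclusionR0OfLowerBSD

/-- The registered stub `stub_etaLower_r0_ofLowerBSD` (skeleton v3 of crux 19601) by name and signature: converse control
modulo Poitou–Tate + Kobayashi 2.2_η/4.1_η + Kitajima–Otsuki 1.3 + modularity + GZK, L₀ currency. CONDITIONAL; closes the
stub, not the crux. [cite: MilneADT2006, Ch. I, Thm. 4.10] [cite: Kobayashi2003, Thm. 2.2 (p. 5), Thm. 4.1 (p. 8)]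
[cite: KitajimaOtsuki2018, Main Thm. 1.3] -/
theorem stub_etaLower_r0_ofLowerBSD :
    poitouTate_selmerStructure_duality_real ℚ →
    Kobayashi2003.thm22_etaSignedSelmerDual_finite_torsion →
    Kobayashi2003.thm41_plusEtaCharIdeal_dvd →
    KitajimaOtsuki2018.mainThm13_etaSignedSelmerDual_noFiniteSubmodule →
    hasEntireLFunction_rat → rank_eq_analyticRank_of_analyticRank_le_one →
    ∀ (V : WeierstrassCurve ℚ) [V.IsElliptic] [V.IsGloballyMinimal] (W : WeierstrassCurve ℚ) [W.IsElliptic]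
      [W.IsGloballyMinimal] (C : VariableChange ℚ) (p : ℕ) [Fact p.Prime],
      5 ≤ p → C • W.quadraticTwist ((-1) ^ (p / 2) * p) = V →
      V.HasGoodReductionAtPrime p → V.frobeniusTrace p = 0 →
      (∀ m : ℕ, V.HasSurjectiveModNGaloisRep (p ^ m : ℕ)) → W.entireLFunction 1 ≠ 0 →
        MissingLowerBoundAt W p → QuadraticBranchPlusEtaLowerInclusionAt V p :=
  fun hPT h22 h41 hKO hmod hGZK V _ _ W _ _ C p _ h5 hCV hg ha hs hL hlow =>
    ConverseControl.quadraticBranchPlusEtaLowerInclusionAt_of_missingLowerBoundAt_of_surjective W p hPT hmod hGZK h22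
      h41 hKO V C h5 hCV hg ha hs hL hlow

end Summit.BirchSwinnertonDyer.BirchSwinnertonDyer.Theorems.PlusEtaLowerInclusionR0OfLowerBSD

end
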